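import Summits.QuantumFields.YangMills.Theorems.FluctuationComparisonRegPrIntLS2BetaRelativeFieldLetterTwoTower
import Summits.QuantumFields.YangMills.Theorems.FluctuationComparisonRegPrIntLS2BetaCorrLetterL2Relative
import Summits.QuantumFields.YangMills.Theorems.FluctuationComparisonRegPrIntLS2BetaRelativeFieldSquareSum
import Literature.MathematicalPhysics.QuantumFieldTheory.Balaban1983to89.T4StairWordPrefix
import HarnessLib

/-!
# S2β · letter (D♮) REL-TEL, feeder F2-rel (UV3-NODE §84.4 (H♭)(i)), FILE C2:
# THE TWO-TOWER BOND LETTERS IN LOCAL SUM CURRENCY — count-box locality of the contour ∕ face loop words (one block ∕ three blocks), and the pointwise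
# two-tower flap bound by NEIGHBOURHOOD SUMS of the four relative data `δ_q(W,W⁰)`, `δ_q(U,U⁰)`, `dev_b(W,W⁰)`, `dev_b(U,U⁰)` (+ the relative spine quotient at faces)

Cell `ym3-torus` (YM ladder rung R3 = continuum `SU(2)` Yang–Mills on the three-torus — a RUNG: NOT d = 4, NOT infinite volume, NOT a mass gap, NOT Clay).
Width seat «width 21» `ym3-torus-px21` (gen 23), FREE px helper on crux `stmt-QuantumFields-20520` (`Theses.UnitScaleTilt.FluctuationComparisonRegPrIntL`);
registry v11.4 `Cruxes/FluctuationComparisonRegPrIntL/Lines/semiclassical_s2beta.lean` 3732b7df FROZEN, untouched.  `--kind proof --supports stmt-QuantumFields-20520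
--as helper`, count-neutral, DEFINITION-FREE (0 `def`, 0 `instance`, 0 `notation`, 0 `sorry`, default heartbeats), any gauge group + px10's commutator letter.

WHY.  FILE C1 ✓`…S2BetaRelativeFieldLetterTwoTower` bounds the two-tower flap `δ(W_b·U_b⁻¹, W⁰_b·U⁰_b⁻¹)` at an interior ∕ face bond by abstract letters `a, b, s, θ₁, θ₂, σ, t`
(relative contour∕face loops of `(W,W⁰)` and `(U,U⁰)`, relative spine quotient, loop sizes, relative comb transport).  This file instantiates every letter by
kernel with LOCAL data — the count boxes of the loop words lie in ONE block (interior, §2) or in the THREE blocks `B(y − e_μ), B(y), B(y + e_μ)` (face, §2) —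
so that each letter is a NEIGHBOURHOOD SUM of a non-negative fine datum near `y = blockOf b₋` (✓p823652 `dist1_holAt_rel_le_local`, ✓p823337 §1
`dist1_holAt_walk_rel_le_local`, lit ✓`LatticeWordStokes.dist1_holAt_le`), the shape FILE C3's bond-indexed Schur bounds turn into `ℓ²`.

CONTENT ([folklore] bookkeeping).
* §1 counts: `natAbs_netDisp_le` (lit ✓`LatticeWordCountBox.netDisp_le_count_true` ∕ `neg_count_false_le_netDisp`), `count_seg_of_ne`∕`_true`∕`_false`,
  `count_flatMap_seg_of_not_mem`, `count_flatMap_seg_le`, ★`count_treeWord_true_le`, ★`count_treeWord_false_le` (reversed words: lit ✓`T4StairWordPrefix.count_wordRev'`).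
* §2 ★`near_walkEnd_of_contour` (count box of the contour word ⊆ the block of `y`), ★`near_walkEnd_of_faceLoop` (count box of the closed face word ⊆ the three blocks
  along `μ`) — both in the «near `y`» form `∀ κ, blockOf (walkEnd (emb y) u) κ ∈ {y κ, y κ ± 1}` of F4's neighbourhood kernels.
* §3 ★★`dist1_flap_rel_le_interior_nbhd`, ★★`dist1_flap_rel_le_face_nbhd` — the pointwise two-tower letters with every input a neighbourhood sum:
  `δ(flap_b, flap⁰_b) ≤ K·(Σ_N δ(W,W⁰) + 2θ_W(K′+2)·Σ_{N_b} dev(W,W⁰)) + K·(Σ_N δ(U,U⁰) + 2θ_U(K′+2)·Σ_{N_b} dev(U,U⁰)) + 2·(Kθ_W + Kθ_U [+ σ])·K′·Σ_{N_b} dev(U,U⁰) [+ s]`,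
  `K′ = (d+2)L`, `K = K′²∕4`, under `PlaqSmall θ_W W`, `PlaqSmall θ_U U` (the SIZE fields: take them from the BACKGROUND tower per px12 g24's 13:07:55Z count — the
  letters are symmetric in the two towers).

HONEST SCOPE.  Word-count bookkeeping and instantiation of landed lemmas; nothing of Bałaban's is asserted; F2-rel in `ℓ²` (FILE C3), (H♭)∕(H♭♭), the BKG-tower size
letter, (D-ax)∕(D♮), (F♮), GAP♯∘ (`stub_uniformFibreGapOrbit`), S2β, the five registered stubs (0∕5), crux 20520, 19936, 19200 and `YM3TorusSU2` are NOT proved; no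
registered stub is closed; rung R3 = SU(2) YM₃ on T³ — NOT d = 4, NOT infinite volume, NOT a mass gap, NOT Clay; the Yang–Mills mass gap is NOT proved.
References: T. Bałaban, CMP **99** (1985) 75–102 [Balaban1985RegularSpaces] (Lemma 1 (1.24)–(1.26) pp.79–80: «the bound for a bond b depends on bounds on
B(c₋) ∪ B(c₊)» — the printed locality); CMP **98** (1985) 17–51 [Balaban1985Averaging] ((19)–(20) p.21, pp.24–25); CMP **109** (1987) 249–301 [Balaban1987RG1]
((0.3)–(0.4) pp.252–253).
-/

set_option autoImplicit false

namespace Summit.QuantumFields.YangMills.Theorems.FluctuationComparisonRegPrIntLS2BetaRelativeFieldLetterTwoTowerLocal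

open Finset
open Literature.MathematicalPhysics.QuantumFieldTheory.Balaban1983to89
open T4Continuum T4ReflectionCone BlockAveraging
open B10Eq47AxialChi (shiftN rowProd)
open B10Eq27TorusAxialLog (rel transl holT axialT contourT holT_eq_holAt transl_apply contourT_eq rel_shift_of_le)
open B7Prop1Explicit (treeWord seg e e_apply)
open T4TiltOscillation (bdev)
open BlockAveragingEMLProp2 (emb_shift_eq_shiftN)
open Summit.QuantumFields.YangMills.Theorems.Prop7AxialGaugeSup (revWord_eq_wordRev)
open Summit.QuantumFields.YangMills.Theorems.FluctuationComparisonRegPrIntLS2BetaIterAxialGaugeOneLevel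
  (noWrap_emb natAbs_rel_emb_le rel_emb_face rel_emb_shift_of_face emb_shift_eq_transl)
open Summit.QuantumFields.YangMills.Theorems.FluctuationComparisonRegPrIntLS2BetaRelativeFieldSquareSum (blockOf_transl_emb)
open Summit.QuantumFields.YangMills.Theorems.FluctuationComparisonRegPrIntLS2BetaCorrLetterL2 (near_self near_shift near_unshift)
open Summit.QuantumFields.YangMills.Theorems.FluctuationComparisonRegPrIntLS2BetaStaircaseSlotStokes (walkEnd_eq_transl)

variable {P : Params} {j : ℕ}

/-! ## §1 Letter counts and net displacements -/

section Counts

variable {d : ℕ}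

/-- `|netDisp w κ| ≤ max(A, B)` whenever `#(+e_κ) ≤ A` and `#(−e_κ) ≤ B`. [folklore] -/
theorem natAbs_netDisp_le {κ : Fin d} {w : List (Letter d)} {A B : ℕ} (hA : w.count (κ, true) ≤ A) (hB : w.count (κ, false) ≤ B) :
    (netDisp w κ).natAbs ≤ max A B := by
  have h1 := LatticeWordCountBox.netDisp_le_count_true κ w
  have h2 := LatticeWordCountBox.neg_count_false_le_netDisp κ w
  rcases le_total A B with hab | hab
  · rw [max_eq_right hab]; omega
  · rw [max_eq_left hab]; omega

/-- A segment in direction `κ` contains no letter of another direction. [folklore] -/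
theorem count_seg_of_ne {ι κ : Fin d} (h : ι ≠ κ) (n : ℤ) (s : Bool) : (seg κ n).count (ι, s) = 0 := by
  cases n <;> simp [seg, List.count_replicate, Ne.symm h]

/-- `#(+e_κ in seg κ n) = n⁺`. [folklore] -/
theorem count_seg_true (κ : Fin d) (n : ℤ) : (seg κ n).count (κ, true) = n.toNat := by
  cases n <;> simp [seg, List.count_replicate]

/-- `#(−e_κ in seg κ n) = n⁻`. [folklore] -/
theorem count_seg_false (κ : Fin d) (n : ℤ) : (seg κ n).count (κ, false) = (-n).toNat := by
  cases n <;> simp [seg, List.count_replicate]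

/-- Segments over directions not containing `l`'s direction contribute no `l`. [folklore] -/
theorem count_flatMap_seg_of_not_mem (v : Fin d → ℤ) (l : Letter d) :
    ∀ ks : List (Fin d), l.1 ∉ ks → (ks.flatMap fun κ => seg κ (v κ)).count l = 0
  | [], _ => by simp
  | κ :: ks, h => by
    rw [List.flatMap_cons, List.count_append, count_flatMap_seg_of_not_mem v l ks (fun h' => h (List.mem_cons_of_mem _ h'))]
    obtain ⟨ι, s⟩ := l
    have hne : ι ≠ κ := fun h' => h (h' ▸ List.mem_cons_self)
    rw [count_seg_of_ne hne, add_zero]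

/-- Over a duplicate-free list of directions the count of `l` is at most that of the one segment in `l`'s direction. [folklore] -/
theorem count_flatMap_seg_le (v : Fin d → ℤ) (l : Letter d) :
    ∀ ks : List (Fin d), ks.Nodup → (ks.flatMap fun κ => seg κ (v κ)).count l ≤ (seg l.1 (v l.1)).count l
  | [], _ => by simp
  | κ :: ks, h => by
    rw [List.nodup_cons] at h
    rw [List.flatMap_cons, List.count_append]
    obtain ⟨ι, s⟩ := l
    by_cases hικ : ι = κ
    · subst hικ
      rw [count_flatMap_seg_of_not_mem v (ι, s) ks h.1, add_zero]
    · rw [count_seg_of_ne hικ, zero_add]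
      exact count_flatMap_seg_le v (ι, s) ks h.2

/-- ★ `#(+e_ι in Γ_v) ≤ (v ι)⁺` for the tree (comb) word `Γ_v`. [cite: Balaban1985Averaging, pp.24-25] -/
theorem count_treeWord_true_le (v : Fin d → ℤ) (ι : Fin d) : (treeWord v).count (ι, true) ≤ (v ι).toNat := by
  have h := count_flatMap_seg_le v (ι, true) (List.finRange d).reverse (List.nodup_reverse.mpr (List.nodup_finRange d))
  rw [count_seg_true] at h
  exact h

/-- ★ `#(−e_ι in Γ_v) ≤ (v ι)⁻`. [cite: Balaban1985Averaging, pp.24-25] -/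
theorem count_treeWord_false_le (v : Fin d → ℤ) (ι : Fin d) : (treeWord v).count (ι, false) ≤ (-(v ι)).toNat := by
  have h := count_flatMap_seg_le v (ι, false) (List.finRange d).reverse (List.nodup_reverse.mpr (List.nodup_finRange d))
  rw [count_seg_false] at h
  exact h

end Counts

/-! ## §2 The count boxes of the contour word (interior) and of the closed face word lie in the block ∕ the three blocks -/

section Locality

/-- `(y − e_μ) + e_μ = y` on the coarse torus. [folklore] -/
private theorem shift_unshift (y : Site P (j + 1)) (μ : Fin P.d) : (y.unshift μ).shift μ = y := by
  funext i
  by_cases h : i = μ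
  · subst h; simp [Site.shift, Site.unshift]
  · simp [Site.shift, Site.unshift, h]

/-- ★ **A WALK WITH SMALL NET DISPLACEMENT FROM A CENTRE STAYS IN THE BLOCK**: `|netDisp u ι| ≤ (L−1)∕2` for all `ι` ⟹ `blockOf (walkEnd (emb y) u) = y` (standing range;
✓`blockOf_transl_emb`). [cite: Balaban1987RG1, (0.1), (0.3) p.252] -/
theorem blockOf_walkEnd_emb (hj : j + 1 ≤ P.m + P.K) (y : Site P (j + 1)) (u : List (Letter P.d)) (hu : ∀ ι, (netDisp u ι).natAbs ≤ (P.L - 1) / 2) :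
    blockOf (walkEnd (emb y) u) = y := by
  rw [walkEnd_eq_transl]
  exact blockOf_transl_emb hj y _ hu

/-- ★ **… AND WITH LONGITUDINAL DISPLACEMENT UP TO `L` STAYS IN THE THREE BLOCKS ALONG `μ`**: `|netDisp u ι| ≤ (L−1)∕2` off `μ` and `|netDisp u μ| ≤ L` ⟹
`blockOf (walkEnd (emb y) u)` is `y − e_μ`, `y` or `y + e_μ`, hence near `y` in the sense of F4's neighbourhood kernels. [cite: Balaban1987RG1, (0.1), (0.3) p.252] -/
theorem near_walkEnd_emb (hj : j + 1 ≤ P.m + P.K) (y : Site P (j + 1)) (μ : Fin P.d) (u : List (Letter P.d))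
    (hT : ∀ ι, ι ≠ μ → (netDisp u ι).natAbs ≤ (P.L - 1) / 2) (hμ : (netDisp u μ).natAbs ≤ P.L) :
    ∀ κ, blockOf (walkEnd (emb y) u) κ = y κ ∨ blockOf (walkEnd (emb y) u) κ = y κ + 1 ∨ blockOf (walkEnd (emb y) u) κ = y κ - 1 := by
  have hL := AveragingRT.two_mul_half_add_one P
  rw [walkEnd_eq_transl]
  by_cases hmid : (netDisp u μ).natAbs ≤ (P.L - 1) / 2
  · have h : blockOf (transl (emb y) fun ν => netDisp u ν) = y :=
      blockOf_transl_emb hj y _ fun ι => by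
        by_cases hι : ι = μ
        · subst hι; exact hmid
        · exact hT ι hι
    rw [h]; exact near_self y
  by_cases hpos : 0 ≤ netDisp u μ
  · -- one block up: `emb y + w = emb (y + e_μ) + (w − L e_μ)`
    have heq : transl (emb y) (fun ν => netDisp u ν) = transl (emb (y.shift μ)) ((fun ν => netDisp u ν) - (P.L : ℤ) • e μ) := by
      rw [emb_shift_eq_transl, ← B10Eq27TorusAxialLog.transl_add, add_sub_cancel]
    have h : blockOf (transl (emb y) fun ν => netDisp u ν) = y.shift μ := by
      rw [heq]
      refine blockOf_transl_emb hj (y.shift μ) _ fun ι => ?_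
      rw [Pi.sub_apply, Pi.smul_apply, e_apply, smul_eq_mul]
      by_cases hι : ι = μ
      · subst hι; rw [if_pos rfl, mul_one]; omega
      · rw [if_neg hι, mul_zero, sub_zero]; exact hT ι hι
    rw [h]; exact near_shift y μ
  · -- one block down: `emb y + w = emb (y − e_μ) + (w + L e_μ)`
    have hy : emb y = transl (emb (y.unshift μ)) ((P.L : ℤ) • e μ) := by rw [← emb_shift_eq_transl, shift_unshift]
    have heq : transl (emb y) (fun ν => netDisp u ν) = transl (emb (y.unshift μ)) ((P.L : ℤ) • e μ + fun ν => netDisp u ν) := by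
      rw [hy, ← B10Eq27TorusAxialLog.transl_add]
    have h : blockOf (transl (emb y) fun ν => netDisp u ν) = y.unshift μ := by
      rw [heq]
      refine blockOf_transl_emb hj (y.unshift μ) _ fun ι => ?_
      rw [Pi.add_apply, Pi.smul_apply, e_apply, smul_eq_mul]
      by_cases hι : ι = μ
      · subst hι; rw [if_pos rfl, mul_one]; omega
      · rw [if_neg hι, mul_zero, zero_add]; exact hT ι hι
    rw [h]; exact near_unshift y μ

/-- ★ **THE COUNT BOX OF THE CONTOUR WORD OF AN INTERIOR BOND LIES IN THE BLOCK**: for `b = ⟨x, μ⟩` with `x`, `x + e_μ` in the block of `y`, every `u` with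
`u.count ≤ (contourT (emb y) b).count` has `|netDisp u ι| ≤ (L−1)∕2` for all `ι`, hence `blockOf (walkEnd (emb y) u) = y`. [cite: Balaban1985RegularSpaces, Lemma 1 p.80] -/
theorem blockOf_walkEnd_of_count_le_contour (hj : j + 1 ≤ P.m + P.K) {x : Site P j} {y : Site P (j + 1)} (hx : blockOf x = y) (μ : Fin P.d)
    (hblock : blockOf (x.shift μ) = y) (u : List (Letter P.d)) (hu : ∀ l, u.count l ≤ (contourT (emb y) ⟨x, μ⟩).count l) :
    blockOf (walkEnd (emb y) u) = y := by
  refine blockOf_walkEnd_emb hj y u fun ι => ?_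
  have hr := natAbs_rel_emb_le hj hx ι
  have hr' := natAbs_rel_emb_le hj hblock ι
  rw [rel_shift_of_le _ _ _ (noWrap_emb hj hx μ), Pi.add_apply, e_apply] at hr'
  have hcnt : ∀ s, u.count (ι, s) ≤ (treeWord (rel (emb y) x)).count (ι, s) + List.count (ι, s) [(μ, true)] +
      (treeWord (rel (emb y) x + e μ)).count (ι, !s) := by
    intro s
    refine (hu (ι, s)).trans (le_of_eq ?_)
    rw [contourT_eq, revWord_eq_wordRev, List.count_append, List.count_append, T4StairWordPrefix.count_wordRev']
  have hT := hcnt true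
  have hF := hcnt false
  simp only [Bool.not_true, Bool.not_false] at hT hF
  have h1 := count_treeWord_true_le (rel (emb y) x) ι
  have h2 := count_treeWord_false_le (rel (emb y) x) ι
  have h3 := count_treeWord_true_le (rel (emb y) x + e μ) ι
  have h4 := count_treeWord_false_le (rel (emb y) x + e μ) ι
  rw [Pi.add_apply, e_apply] at h3 h4
  have h6 : List.count (ι, false) [(μ, true)] = 0 := List.count_eq_zero.mpr (by simp)
  by_cases h : ι = μ
  · subst h
    rw [if_pos rfl] at hr' h3 h4
    have h5 : List.count (ι, true) [(ι, true)] = 1 := by simp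
    refine (natAbs_netDisp_le le_rfl le_rfl).trans (max_le ?_ ?_) <;> omega
  · rw [if_neg h] at hr' h3 h4
    have h5 : List.count (ι, true) [(μ, true)] = 0 := List.count_eq_zero.mpr (by simp [h])
    refine (natAbs_netDisp_le le_rfl le_rfl).trans (max_le ?_ ?_) <;> omega

/-- ★ **THE COUNT BOX OF THE CLOSED FACE WORD LIES IN THE THREE BLOCKS ALONG `μ`**: for `b = ⟨x, μ⟩` with `x` on the `μ`-face of the block of `y`, every `u` with
`u.count ≤ (face loop word).count` has `|netDisp u ι| ≤ (L−1)∕2` off `μ` and `|netDisp u μ| ≤ L`, hence `blockOf (walkEnd (emb y) u)` is near `y`.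
[cite: Balaban1985RegularSpaces, Lemma 1 p.80] -/
theorem near_walkEnd_of_count_le_faceLoop (hj : j + 1 ≤ P.m + P.K) {x : Site P j} {y : Site P (j + 1)} (hx : blockOf x = y) {μ : Fin P.d}
    (hface : (x μ).val % P.L + 1 = P.L) (u : List (Letter P.d))
    (hu : ∀ l, u.count l ≤ ((treeWord (rel (emb y) x) ++ [(μ, true)] ++ wordRev (treeWord (rel (emb (y.shift μ)) (x.shift μ)))) ++
      List.replicate P.L (μ, false)).count l) :
    ∀ κ, blockOf (walkEnd (emb y) u) κ = y κ ∨ blockOf (walkEnd (emb y) u) κ = y κ + 1 ∨ blockOf (walkEnd (emb y) u) κ = y κ - 1 := by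
  have hL := AveragingRT.two_mul_half_add_one P
  have hr := fun ι => natAbs_rel_emb_le hj hx ι
  have hrμ := rel_emb_face hj hx hface
  have hr' : ∀ κ, rel (emb (y.shift μ)) (x.shift μ) κ = if κ = μ then -(((P.L - 1) / 2 : ℕ) : ℤ) else rel (emb y) x κ := by
    intro κ
    rw [rel_emb_shift_of_face hj hx hface, Pi.sub_apply, Pi.add_apply, Pi.smul_apply, e_apply, smul_eq_mul]
    by_cases hκ : κ = μ
    · subst hκ; rw [if_pos rfl, if_pos rfl, hrμ]; push_cast; omega
    · rw [if_neg hκ, if_neg hκ]; ring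
  have hcnt : ∀ ι s, u.count (ι, s) ≤ (treeWord (rel (emb y) x)).count (ι, s) + List.count (ι, s) [(μ, true)] +
      (treeWord (rel (emb (y.shift μ)) (x.shift μ))).count (ι, !s) + List.count (ι, s) (List.replicate P.L (μ, false)) := by
    intro ι s
    refine (hu (ι, s)).trans (le_of_eq ?_)
    rw [List.count_append, List.count_append, List.count_append, T4StairWordPrefix.count_wordRev']
  refine near_walkEnd_emb hj y μ u (fun ι hι => ?_) ?_
  · have hT := hcnt ι true
    have hF := hcnt ι false
    have h1 := count_treeWord_true_le (rel (emb y) x) ι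
    have h2 := count_treeWord_false_le (rel (emb y) x) ι
    have h3 := count_treeWord_true_le (rel (emb (y.shift μ)) (x.shift μ)) ι
    have h4 := count_treeWord_false_le (rel (emb (y.shift μ)) (x.shift μ)) ι
    rw [hr' ι, if_neg hι] at h3 h4
    have h5 : List.count (ι, true) [(μ, true)] = 0 := List.count_eq_zero.mpr (by simp [hι])
    have h6 : List.count (ι, false) [(μ, true)] = 0 := List.count_eq_zero.mpr (by simp)
    have h7 : List.count (ι, true) (List.replicate P.L (μ, false)) = 0 := List.count_eq_zero.mpr (by simp)
    have h8 : List.count (ι, false) (List.replicate P.L (μ, false)) = 0 :=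
      List.count_eq_zero.mpr (fun hm => hι (by have := List.eq_of_mem_replicate hm; simpa using this))
    simp only [Bool.not_true, Bool.not_false] at hT hF
    have := hr ι
    refine (natAbs_netDisp_le le_rfl le_rfl).trans (max_le ?_ ?_) <;> omega
  · have hT := hcnt μ true
    have hF := hcnt μ false
    have h1 := count_treeWord_true_le (rel (emb y) x) μ
    have h2 := count_treeWord_false_le (rel (emb y) x) μ
    have h3 := count_treeWord_true_le (rel (emb (y.shift μ)) (x.shift μ)) μ
    have h4 := count_treeWord_false_le (rel (emb (y.shift μ)) (x.shift μ)) μ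
    rw [hr' μ, if_pos rfl] at h3 h4
    rw [hrμ] at h1 h2
    have h5 : List.count (μ, true) [(μ, true)] = 1 := by simp
    have h6 : List.count (μ, false) [(μ, true)] = 0 := List.count_eq_zero.mpr (by simp)
    have h7 : List.count (μ, true) (List.replicate P.L (μ, false)) = 0 := List.count_eq_zero.mpr (by simp)
    have h8 : List.count (μ, false) (List.replicate P.L (μ, false)) = P.L := by simp
    simp only [Bool.not_true, Bool.not_false] at hT hF
    refine (natAbs_netDisp_le le_rfl le_rfl).trans (max_le ?_ ?_) <;> omega

end Locality

end Summit.QuantumFields.YangMills.Theorems.FluctuationComparisonRegPrIntLS2BetaRelativeFieldLetterTwoTowerLocal
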